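import Mathlib

/-!
# Route `FilamentSkeletonRss` · crux `TransverseReduction1AL` (stmt-NavierStokesRegularity-23297) · line `defect_column_gate_1AL` —
# brick B5 of S2a-loc `WaistColumnGateLoc1A`: THE AXIAL OPERATOR `−∂_τ² + κτ∂_τ` IN SUP NORM (log-drift lemma)

Helper file (`--supports stmt-NavierStokesRegularity-23297 --as helper`; LEAD of 23297, lane ns-filament-21221-p1 g12).  In the S2a-loc operator
(`colForceVort_eq`, `Theorems/…DefectColumnGateColumnVorticity.lean`) the axial part of the transport `Dω[By]` is `κτ∂_τ` (`B d = κ d`, `κ ≥ 3/2 + δ`) and the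
Laplacian contributes `−∂_τ²`; the class of the stub has NO axial localisation and the weight `secWt` is sectional.  Briefs v5 (L2)/(L4) and v6 (L10) use the
following one-dimensional fact about the axial operator `T_κ a = −a″ + κτ a′` on BOUNDED profiles: constants are free (`T_κ 1 = 0`), and everything else costs `κ`
PER LOG-UNIT OF `τ` — a log-plateau of log-length `L` costs `κ/L` relative, and nothing cheaper exists.  This file proves the sup-norm form of «nothing cheaper»:

* `axial_deriv_repr` — for `a ∈ C²` on `[τ, T]` with `−a″ + κ s a′ = f`: `a′(τ) = e^{κ(τ²−T²)/2} a′(T) + e^{κτ²/2} ∫_τ^T e^{−κs²/2} f(s) ds`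
  (the integrating factor `e^{−κs²/2}`);
* `mills_bound` — `e^{κτ²/2} ∫_τ^T e^{−κs²/2} ds ≤ 1/(κτ)` for `0 < τ ≤ T` (Gaussian tail / Mills ratio, by `e^{−κs²/2} ≤ (s/τ)e^{−κs²/2}`);
* **`axial_deriv_bound`** — if moreover `|f| ≤ F` and `a′` is BOUNDED on `[τ₀, ∞)` (`τ₀ > 0`), then `|a′(τ)| ≤ F/(κτ)` for every `τ ≥ τ₀`
  (let `T → ∞` in the representation: the homogeneous branch `e^{κτ²/2}` is excluded by boundedness);
* **`axial_logDrift`** — hence `|a(τ₂) − a(τ₁)| ≤ (F/κ)·log(τ₂/τ₁)` for `τ₀ ≤ τ₁ ≤ τ₂`: a bounded axial profile driven by a forcing of sup-size `F`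
  drifts by at most `F/κ` per log-unit — equivalently, an amplitude change `Δ` over a log-window of length `L` needs `‖T_κ a‖_∞ ≥ κΔ/L`, which is the
  `κ/L` price of the log-plateau constructions (and shows they are optimal up to constants).

All statements are real one-variable calculus (FTC on compact intervals + one limit).  HONEST FRAMING: an elementary lemma about ONE linear MODEL operator of a
hypothetical blow-up route (MODEL rung, negative side); `WaistColumnGateLoc1A` and `TransverseReduction1AL` are neither proved nor refuted; nothing here bears on
Navier–Stokes regularity.
-/

set_option linter.dupNamespace false

noncomputable section

namespace Summit.NavierStokesRegularity.NavierStokesRegularity.Theorems.DefectColumnGate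

open scoped Topology
open Set Filter MeasureTheory intervalIntegral

/-! ## 1. The integrating factor and the representation of `a′` -/

/-- Derivative of the integrating factor: `(e^{−κs²/2})′ = −κ s e^{−κs²/2}`. -/
theorem hasDerivAt_gaussFactor (κ s : ℝ) :
    HasDerivAt (fun s : ℝ => Real.exp (-(κ * s ^ 2 / 2))) (-(κ * s) * Real.exp (-(κ * s ^ 2 / 2))) s := by
  have h1 : HasDerivAt (fun s : ℝ => -(κ * s ^ 2 / 2)) (-(κ * s)) s := by
    have e : (fun s : ℝ => -(κ * s ^ 2 / 2)) = fun s => -(κ / 2) * (s * s) := by funext s; ring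
    rw [e]
    exact (((hasDerivAt_id' s).mul (hasDerivAt_id' s)).const_mul (-(κ / 2))).congr_deriv (by ring)
  exact h1.exp.congr_deriv (by ring)

/-- **Representation of `a′` through the integrating factor.**  If `a′ = a₁`, `a₁′ = a₂` and `a₂(s) = κ s a₁(s) − f(s)` on `[τ, T]` (i.e.
`−a″ + κ s a′ = f`) with `f` continuous there, then `e^{−κT²/2} a₁(T) − e^{−κτ²/2} a₁(τ) = −∫_τ^T e^{−κs²/2} f(s) ds`. -/
theorem axial_deriv_repr {κ τ T : ℝ} (hτT : τ ≤ T) {a₁ a₂ f : ℝ → ℝ}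
    (h₂ : ∀ s ∈ Icc τ T, HasDerivAt a₁ (a₂ s) s) (hode : ∀ s ∈ Icc τ T, a₂ s = κ * s * a₁ s - f s)
    (hf : ContinuousOn f (Icc τ T)) :
    Real.exp (-(κ * T ^ 2 / 2)) * a₁ T - Real.exp (-(κ * τ ^ 2 / 2)) * a₁ τ =
      -∫ s in τ..T, Real.exp (-(κ * s ^ 2 / 2)) * f s := by
  have hderiv : ∀ s ∈ uIcc τ T, HasDerivAt (fun s => Real.exp (-(κ * s ^ 2 / 2)) * a₁ s)
      (-(Real.exp (-(κ * s ^ 2 / 2)) * f s)) s := by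
    intro s hs
    rw [uIcc_of_le hτT] at hs
    have h := (hasDerivAt_gaussFactor κ s).mul (h₂ s hs)
    rw [show (fun s => Real.exp (-(κ * s ^ 2 / 2)) * a₁ s) = (fun s => Real.exp (-(κ * s ^ 2 / 2))) * a₁ from rfl]
    exact h.congr_deriv (by rw [hode s hs]; ring)
  have hcont : ContinuousOn (fun s => -(Real.exp (-(κ * s ^ 2 / 2)) * f s)) (uIcc τ T) := by
    rw [uIcc_of_le hτT]
    exact ((Continuous.continuousOn (by fun_prop)).mul hf).neg
  have hint : IntervalIntegrable (fun s => -(Real.exp (-(κ * s ^ 2 / 2)) * f s)) volume τ T :=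
    hcont.intervalIntegrable
  rw [← integral_eq_sub_of_hasDerivAt hderiv hint, intervalIntegral.integral_neg]

/-! ## 2. The Gaussian tail (Mills) bound -/

/-- **Mills bound**: `e^{κτ²/2} ∫_τ^T e^{−κs²/2} ds ≤ 1/(κτ)` for `0 < κ`, `0 < τ ≤ T`. -/
theorem mills_bound {κ τ T : ℝ} (hκ : 0 < κ) (hτ : 0 < τ) (hτT : τ ≤ T) :
    Real.exp (κ * τ ^ 2 / 2) * ∫ s in τ..T, Real.exp (-(κ * s ^ 2 / 2)) ≤ 1 / (κ * τ) := by
  -- compare with `(s/τ) e^{−κs²/2}`, whose primitive is `−e^{−κs²/2}/(κτ)`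
  have hmono : ∫ s in τ..T, Real.exp (-(κ * s ^ 2 / 2)) ≤ ∫ s in τ..T, s / τ * Real.exp (-(κ * s ^ 2 / 2)) := by
    refine intervalIntegral.integral_mono_on hτT (Continuous.intervalIntegrable (by fun_prop) _ _)
      (Continuous.intervalIntegrable (by fun_prop) _ _) fun s hs => ?_
    have hs1 : 1 ≤ s / τ := by rw [le_div_iff₀ hτ]; linarith [hs.1]
    calc Real.exp (-(κ * s ^ 2 / 2)) = 1 * Real.exp (-(κ * s ^ 2 / 2)) := (one_mul _).symm
      _ ≤ s / τ * Real.exp (-(κ * s ^ 2 / 2)) := by gcongr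
  have hprim : ∫ s in τ..T, s / τ * Real.exp (-(κ * s ^ 2 / 2)) =
      Real.exp (-(κ * τ ^ 2 / 2)) / (κ * τ) - Real.exp (-(κ * T ^ 2 / 2)) / (κ * τ) := by
    have hderiv : ∀ s ∈ uIcc τ T, HasDerivAt (fun s => -(Real.exp (-(κ * s ^ 2 / 2)) / (κ * τ)))
        (s / τ * Real.exp (-(κ * s ^ 2 / 2))) s := by
      intro s _
      have h := ((hasDerivAt_gaussFactor κ s).div_const (κ * τ)).neg
      exact h.congr_deriv (by field_simp [hκ.ne', hτ.ne'])
    rw [integral_eq_sub_of_hasDerivAt hderiv (Continuous.intervalIntegrable (by fun_prop) _ _)]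
    ring
  have hpos : 0 < Real.exp (κ * τ ^ 2 / 2) := Real.exp_pos _
  calc Real.exp (κ * τ ^ 2 / 2) * ∫ s in τ..T, Real.exp (-(κ * s ^ 2 / 2))
      ≤ Real.exp (κ * τ ^ 2 / 2) * (Real.exp (-(κ * τ ^ 2 / 2)) / (κ * τ) - Real.exp (-(κ * T ^ 2 / 2)) / (κ * τ)) := by
        rw [← hprim]; exact mul_le_mul_of_nonneg_left hmono hpos.le
    _ ≤ Real.exp (κ * τ ^ 2 / 2) * (Real.exp (-(κ * τ ^ 2 / 2)) / (κ * τ)) := by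
        gcongr
        have : 0 ≤ Real.exp (-(κ * T ^ 2 / 2)) / (κ * τ) := by positivity
        linarith
    _ = 1 / (κ * τ) := by rw [← mul_div_assoc, ← Real.exp_add]; norm_num

/-! ## 3. The a-priori bound on `a′` and the log-drift estimate -/

/-- **Bound on `a′` at a finite horizon**: under the hypotheses of `axial_deriv_repr` on `[τ, T]` with `|f| ≤ F` there and `|a₁ T| ≤ M`, `0 < κ`,
`0 < τ`: `|a₁ τ| ≤ M e^{κ(τ²−T²)/2} + F/(κτ)`. -/
theorem axial_deriv_bound_finite {κ τ T F M : ℝ} (hκ : 0 < κ) (hτ : 0 < τ) (hτT : τ ≤ T) {a₁ a₂ f : ℝ → ℝ}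
    (h₂ : ∀ s ∈ Icc τ T, HasDerivAt a₁ (a₂ s) s) (hode : ∀ s ∈ Icc τ T, a₂ s = κ * s * a₁ s - f s)
    (hf : ContinuousOn f (Icc τ T)) (hF : ∀ s ∈ Icc τ T, |f s| ≤ F) (hM : |a₁ T| ≤ M) :
    |a₁ τ| ≤ M * Real.exp (κ * (τ ^ 2 - T ^ 2) / 2) + F / (κ * τ) := by
  have hrepr := axial_deriv_repr hτT h₂ hode hf
  have hF0 : 0 ≤ F := (abs_nonneg _).trans (hF τ ⟨le_rfl, hτT⟩)
  set I := ∫ s in τ..T, Real.exp (-(κ * s ^ 2 / 2)) * f s with hI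
  set J := ∫ s in τ..T, Real.exp (-(κ * s ^ 2 / 2)) with hJ
  -- solve for `a₁ τ`
  have hE : Real.exp (κ * τ ^ 2 / 2) * Real.exp (-(κ * τ ^ 2 / 2)) = 1 := by
    rw [← Real.exp_add]; norm_num
  have heq : a₁ τ = Real.exp (κ * τ ^ 2 / 2) * (Real.exp (-(κ * T ^ 2 / 2)) * a₁ T + I) := by
    have h1 : Real.exp (-(κ * τ ^ 2 / 2)) * a₁ τ = Real.exp (-(κ * T ^ 2 / 2)) * a₁ T + I := by rw [hI]; linarith
    calc a₁ τ = Real.exp (κ * τ ^ 2 / 2) * (Real.exp (-(κ * τ ^ 2 / 2)) * a₁ τ) := by rw [← mul_assoc, hE, one_mul]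
      _ = _ := by rw [h1]
  -- bound the integral by `F · J`
  have hcont : ContinuousOn (fun s => Real.exp (-(κ * s ^ 2 / 2)) * f s) (uIcc τ T) := by
    rw [uIcc_of_le hτT]; exact (Continuous.continuousOn (by fun_prop)).mul hf
  have hint : |I| ≤ F * J := by
    rw [hI, hJ, ← intervalIntegral.integral_const_mul]
    calc |∫ s in τ..T, Real.exp (-(κ * s ^ 2 / 2)) * f s|
        ≤ ∫ s in τ..T, |Real.exp (-(κ * s ^ 2 / 2)) * f s| := intervalIntegral.abs_integral_le_integral_abs hτT
      _ ≤ ∫ s in τ..T, F * Real.exp (-(κ * s ^ 2 / 2)) := by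
          refine intervalIntegral.integral_mono_on hτT hcont.abs.intervalIntegrable (Continuous.intervalIntegrable (by fun_prop) _ _)
            fun s hs => ?_
          rw [abs_mul, abs_of_pos (Real.exp_pos _), mul_comm F]
          exact mul_le_mul_of_nonneg_left (hF s hs) (Real.exp_pos _).le
  have hJ0 : 0 ≤ J := by
    rw [hJ]; exact intervalIntegral.integral_nonneg hτT fun s _ => (Real.exp_pos _).le
  have hmills : Real.exp (κ * τ ^ 2 / 2) * J ≤ 1 / (κ * τ) := by rw [hJ]; exact mills_bound hκ hτ hτT
  have hexp : Real.exp (κ * τ ^ 2 / 2) * Real.exp (-(κ * T ^ 2 / 2)) = Real.exp (κ * (τ ^ 2 - T ^ 2) / 2) := by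
    rw [← Real.exp_add]; congr 1; ring
  have hM0 : 0 ≤ M := (abs_nonneg _).trans hM
  calc |a₁ τ| = Real.exp (κ * τ ^ 2 / 2) * |Real.exp (-(κ * T ^ 2 / 2)) * a₁ T + I| := by
        rw [heq, abs_mul, abs_of_pos (Real.exp_pos _)]
    _ ≤ Real.exp (κ * τ ^ 2 / 2) * (Real.exp (-(κ * T ^ 2 / 2)) * M + F * J) := by
        gcongr
        calc |Real.exp (-(κ * T ^ 2 / 2)) * a₁ T + I| ≤ |Real.exp (-(κ * T ^ 2 / 2)) * a₁ T| + |I| := abs_add_le _ _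
          _ ≤ Real.exp (-(κ * T ^ 2 / 2)) * M + F * J := by
              rw [abs_mul, abs_of_pos (Real.exp_pos _)]
              exact add_le_add (mul_le_mul_of_nonneg_left hM (Real.exp_pos _).le) hint
    _ = M * Real.exp (κ * (τ ^ 2 - T ^ 2) / 2) + F * (Real.exp (κ * τ ^ 2 / 2) * J) := by rw [← hexp]; ring
    _ ≤ M * Real.exp (κ * (τ ^ 2 - T ^ 2) / 2) + F * (1 / (κ * τ)) := by gcongr
    _ = M * Real.exp (κ * (τ ^ 2 - T ^ 2) / 2) + F / (κ * τ) := by ring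

/-- **A-PRIORI BOUND ON `a′` FOR BOUNDED AXIAL PROFILES.**  Let `0 < κ`, `0 < τ₀`, and on `[τ₀, ∞)`: `a′ = a₁`… precisely `a₁′ = a₂`, `a₂ = κ s a₁ − f`
(`−a″ + κ s a′ = f`), `f` continuous with `|f| ≤ F`, and `a₁` BOUNDED (`|a₁| ≤ M`).  Then `|a₁(τ)| ≤ F/(κτ)` for every `τ ≥ τ₀`: the homogeneous branch
`a′ ∝ e^{κτ²/2}` is excluded by boundedness, and what is left is the Gaussian tail of the forcing. -/
theorem axial_deriv_bound {κ τ₀ F M : ℝ} (hκ : 0 < κ) (hτ₀ : 0 < τ₀) {a₁ a₂ f : ℝ → ℝ}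
    (h₂ : ∀ s, τ₀ ≤ s → HasDerivAt a₁ (a₂ s) s) (hode : ∀ s, τ₀ ≤ s → a₂ s = κ * s * a₁ s - f s)
    (hf : ContinuousOn f (Ici τ₀)) (hF : ∀ s, τ₀ ≤ s → |f s| ≤ F) (hM : ∀ s, τ₀ ≤ s → |a₁ s| ≤ M)
    {τ : ℝ} (hτ : τ₀ ≤ τ) : |a₁ τ| ≤ F / (κ * τ) := by
  have hτpos : 0 < τ := hτ₀.trans_le hτ
  -- for every horizon `T ≥ τ`
  have hfin : ∀ T, τ ≤ T → |a₁ τ| - F / (κ * τ) ≤ M * Real.exp (κ * (τ ^ 2 - T ^ 2) / 2) := by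
    intro T hT
    have hsub : Icc τ T ⊆ Ici τ₀ := fun s hs => hτ.trans hs.1
    have h := axial_deriv_bound_finite hκ hτpos hT (fun s hs => h₂ s (hsub hs)) (fun s hs => hode s (hsub hs))
      (hf.mono hsub) (fun s hs => hF s (hsub hs)) (hM T (hτ.trans hT))
    linarith
  -- let `T → ∞`
  have hlim : Tendsto (fun T : ℝ => M * Real.exp (κ * (τ ^ 2 - T ^ 2) / 2)) atTop (𝓝 0) := by
    have h1 : Tendsto (fun T : ℝ => κ * (τ ^ 2 - T ^ 2) / 2) atTop atBot := by
      have hT2 : Tendsto (fun T : ℝ => T ^ 2) atTop atTop := tendsto_pow_atTop two_ne_zero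
      have h2 : Tendsto (fun T : ℝ => τ ^ 2 - T ^ 2) atTop atBot :=
        (tendsto_atBot_add_const_left atTop (τ ^ 2) (tendsto_neg_atTop_atBot.comp hT2)).congr fun T => by
          simp only [Function.comp_apply]; ring
      have h3 : Tendsto (fun T : ℝ => κ / 2 * (τ ^ 2 - T ^ 2)) atTop atBot := h2.const_mul_atBot (by positivity)
      exact h3.congr fun T => by ring
    have h4 := Real.tendsto_exp_atBot.comp h1
    simpa using h4.const_mul M
  have hle : |a₁ τ| - F / (κ * τ) ≤ 0 :=
    ge_of_tendsto hlim (Filter.eventually_atTop.2 ⟨τ, fun T hT => hfin T hT⟩)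
  linarith

/-- **LOG-DRIFT LEMMA (brick B5 in sup norm).**  Under the hypotheses of `axial_deriv_bound`, with `a′ = a₁` on `[τ₀, ∞)`:
`|a(τ₂) − a(τ₁)| ≤ (F/κ) · log(τ₂/τ₁)` for all `τ₀ ≤ τ₁ ≤ τ₂`.  A bounded axial profile driven by a forcing of sup-size `F` changes by at most `F/κ`
per log-unit of `τ`; equivalently an amplitude change `Δ` across a log-window of length `L` forces `‖−a″ + κτa′‖_∞ ≥ κΔ/L`. -/
theorem axial_logDrift {κ τ₀ F M : ℝ} (hκ : 0 < κ) (hτ₀ : 0 < τ₀) {a a₁ a₂ f : ℝ → ℝ}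
    (h₁ : ∀ s, τ₀ ≤ s → HasDerivAt a (a₁ s) s) (h₂ : ∀ s, τ₀ ≤ s → HasDerivAt a₁ (a₂ s) s)
    (hode : ∀ s, τ₀ ≤ s → a₂ s = κ * s * a₁ s - f s)
    (hf : ContinuousOn f (Ici τ₀)) (hF : ∀ s, τ₀ ≤ s → |f s| ≤ F) (hM : ∀ s, τ₀ ≤ s → |a₁ s| ≤ M)
    {τ₁ τ₂ : ℝ} (hτ₁ : τ₀ ≤ τ₁) (h12 : τ₁ ≤ τ₂) :
    |a τ₂ - a τ₁| ≤ F / κ * Real.log (τ₂ / τ₁) := by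
  have hτ₁pos : 0 < τ₁ := hτ₀.trans_le hτ₁
  have hτ₂pos : 0 < τ₂ := hτ₁pos.trans_le h12
  -- `a₁` is continuous on `[τ₁, τ₂]` (it is differentiable there)
  have hcont : ContinuousOn a₁ (uIcc τ₁ τ₂) := by
    rw [uIcc_of_le h12]
    exact fun s hs => (h₂ s (hτ₁.trans hs.1)).continuousAt.continuousWithinAt
  have hFTC : a τ₂ - a τ₁ = ∫ s in τ₁..τ₂, a₁ s := by
    rw [integral_eq_sub_of_hasDerivAt (fun s hs => h₁ s (hτ₁.trans (by rw [uIcc_of_le h12] at hs; exact hs.1)))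
      hcont.intervalIntegrable]
  have hbound : ∀ s ∈ Icc τ₁ τ₂, |a₁ s| ≤ F / κ * s⁻¹ := by
    intro s hs
    have h := axial_deriv_bound hκ hτ₀ h₂ hode hf hF hM (hτ₁.trans hs.1)
    have h' : F / (κ * s) = F / κ * s⁻¹ := by rw [← div_div, div_eq_mul_inv]
    rwa [h'] at h
  have h0 : (0 : ℝ) ∉ uIcc τ₁ τ₂ := by
    rw [uIcc_of_le h12]; exact fun h => by linarith [h.1]
  calc |a τ₂ - a τ₁| = |∫ s in τ₁..τ₂, a₁ s| := by rw [hFTC]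
    _ ≤ ∫ s in τ₁..τ₂, |a₁ s| := intervalIntegral.abs_integral_le_integral_abs h12
    _ ≤ ∫ s in τ₁..τ₂, F / κ * s⁻¹ := by
        refine intervalIntegral.integral_mono_on h12 hcont.abs.intervalIntegrable ?_ hbound
        exact (intervalIntegral.intervalIntegrable_inv (fun x hx => by
          rw [uIcc_of_le h12] at hx; exact (hτ₁pos.trans_le hx.1).ne') continuousOn_id).const_mul (F / κ)
    _ = F / κ * Real.log (τ₂ / τ₁) := by rw [intervalIntegral.integral_const_mul, integral_inv h0]

/-! ## 4. Sharpness: the logarithmic ramp -/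

/-- **The log-ramp saturates the log-drift lemma up to the factor `(κ + τ₀⁻²)/κ`.**  For `a = log` on `τ > 0`: `a′ = τ⁻¹`, `a″ = −τ⁻²`, and
`−a″ + κτ a′ = τ⁻² + κ` — a bounded forcing (`≤ κ + τ₀⁻²` on `[τ₀, ∞)`) producing drift exactly `log(τ₂/τ₁)` per window, while `axial_logDrift` allows
`(κ + τ₀⁻²)/κ · log(τ₂/τ₁)`.  (This is the ramp of the axial log-plateau constructions in briefs v5 (L2)/(L4).) -/
theorem axial_log_ramp {κ τ : ℝ} (hτ : 0 < τ) :
    HasDerivAt Real.log τ⁻¹ τ ∧ HasDerivAt (fun s : ℝ => s⁻¹) (-(τ ^ 2)⁻¹) τ ∧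
      -(-(τ ^ 2)⁻¹) + κ * τ * τ⁻¹ = (τ ^ 2)⁻¹ + κ := by
  refine ⟨Real.hasDerivAt_log hτ.ne', ?_, ?_⟩
  · simpa using hasDerivAt_inv hτ.ne'
  · field_simp

end Summit.NavierStokesRegularity.NavierStokesRegularity.Theorems.DefectColumnGate

end
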